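import Mathlib
import Summits.KontsevichZagierPeriods.Zeta5Search.Families.DualRateConjectureD
import Summits.KontsevichZagierPeriods.Zeta5Search.Brown8.RayQRateLimit
import HarnessLib

/-!
# ζ(5) search — Families: every live Brown–Zudilin ray's growth constant is PINNED — `rayQRate = −log raySup(dual ray)`

HONEST FRAMING: systematic search; no irrationality claim unless certified.  Cell `pub-zeta5`, certifier 2
(cert-2 g9, 2026-08-22).  A corollary of Conjecture D (`Families/DualRateConjectureD`); nothing about `ζ(5)`; no number
of record moves; no conjecture node is used.

fam-brown8 g8 (`Brown8/RayQRateLimit`) proved that on every ray of the general family with `Q(a) ≠ 0` the limit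
`rayQRate = lim log|Q(n·a)|/n` EXISTS (Fekete), remarking that "pinning it needs a two-sided certificate".  Conjecture D
pins all of them at once: **`rayQRate_eq_neg_log_raySup_dual`** — for every `a` with `Converges a` and `Q(a) ≠ 0`,
`Brown8.rayQRate (pOf a) (qOf a) = −log raySup(₈π₈; bzDen a, bzNum a)`, the log of the minimum of the cellular integrand over
the DUAL cell (`Families/RayGrowthDuality`), a variational (algebraic) number.  Standard axioms only.
-/

noncomputable section

open Real Filter Topology

namespace Summit.KontsevichZagierPeriods.Zeta5Search.Families.Cellular

open Literature.NumberTheory.Irrationality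

namespace DualRate

/-- The hypotheses of `Brown8.rayQRate` for a convergent parameter vector: `q₁(a) = a₄ ≥ 0`. -/
theorem qOf_zero_nonneg {a : Fin 8 → ℤ} (hC : BrownZudilin2022.Converges a) : 0 ≤ BrownZudilin2022.qOf a 0 := by
  have h := hC (a 3) (by simp [BrownZudilin2022.convergenceForms])
  simpa [BrownZudilin2022.qOf] using h

/-- The hypotheses of `Brown8.rayQRate` for a convergent parameter vector: `q₄(a) = a₁ ≥ 0`. -/
theorem qOf_three_nonneg {a : Fin 8 → ℤ} (hC : BrownZudilin2022.Converges a) : 0 ≤ BrownZudilin2022.qOf a 3 := by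
  have h := hC (a 0) (by simp [BrownZudilin2022.convergenceForms])
  simpa [BrownZudilin2022.qOf] using h

/-- **Every live ray is pinned**: for `Converges a` and `Q(a) ≠ 0`, fam-brown8's Fekete limit `rayQRate` of
`log|Q(n·a)|/n` equals `−log raySup(₈π₈; bzDen a, bzNum a)`. -/
theorem rayQRate_eq_neg_log_raySup_dual {a : Fin 8 → ℤ} (hC : BrownZudilin2022.Converges a)
    (hQ : BrownZudilin2022.QOf a ≠ 0) :
    Brown8.rayQRate (BrownZudilin2022.pOf a) (BrownZudilin2022.qOf a) (qOf_zero_nonneg hC) (qOf_three_nonneg hC) hQ =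
      -Real.log (raySup pi8dualInv (bzDen a) (bzNum a)) := by
  have h1 := Brown8.tendsto_log_absQ_div (BrownZudilin2022.pOf a) (BrownZudilin2022.qOf a) (qOf_zero_nonneg hC)
    (qOf_three_nonneg hC) hQ
  have h2 := leadingCoeffRateIsDualDecay_holds a hC
  have h3 : (fun n : ℕ => Real.log (Brown8.absQ (BrownZudilin2022.pOf a) (BrownZudilin2022.qOf a) n) / n) =
      fun n : ℕ => Real.log |(BrownZudilin2022.QOf (fun i => (n : ℤ) * a i) : ℝ)| / n := by
    funext n
    have e : Brown8.absQ (BrownZudilin2022.pOf a) (BrownZudilin2022.qOf a) n =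
        |(BrownZudilin2022.QOf (Brown8.ray a n) : ℝ)| := by
      rw [Brown8.absQ, BrownZudilin2022.QOf, Brown8.pOf_ray, Brown8.qOf_ray]
    rw [e]
    rfl
  rw [h3] at h1
  exact tendsto_nhds_unique h1 h2

end DualRate

end Summit.KontsevichZagierPeriods.Zeta5Search.Families.Cellular
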